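import Summits.AtomisticToContinuum.HydrodynamicLimit.Theorems.InformationPercolationEnginePercolationClosesChaosDockingCells
import Literature.Analysis.FluidPDE.HardSphereRegularGeometry
import HarnessLib

/-!
# Docking S7 of the line `equilibrium-forecast-chain-rule` (crux `InformationPercolationEngine.PercolationClosesChaos`,
stmt-AtomisticToContinuum-15178) — piece C1: the collision triples of a window and the row/owner dictionary

Support file (`--supports stmt-AtomisticToContinuum-15178`) of the registered stub `stub_docking` (worker S7 of lead c1).
On the good set of the flow a collision pair sum over a bounded window is an honest finite sum over the COLLISION TRIPLES
`(s, i, j)` (time in the window, ordered contact pair at that time). This file packages that finite set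
(`collTriples Φ W z`, `collisionPairSum_eq_sum_collTriples`, `swap_mem_collTriples`) and reads the line's cell-pair
statistics of a step through it: `collPair`, `rowCount`, `ownedCount` as finite sums over the triples of the step
(`collPair_eq_sum`, `rowCount_eq_sum`, `ownedCount_eq_sum`), whence

* `abs_collPair_le`: `|collPair Ψ| ≤ C · collPair 1` for `|Ψ| ≤ C`;
* `sum_collPair_eq`: `Σ_{q' ∈ box} collPair Ψ (q, q') = (n̄c)⁻¹ Σ_{triples, start cell of i = q} Ψ(mark)`, in particular
  `rowCount q = Σ_{q'} collPair 1 (q, q')` (`rowCount_eq_sum_collPair`);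
* `ownedCount_le_two_mul_rowCount` (registered helper): every ordered contact pair appears in both orders
  (`swap_mem_contactPairs_iff`, regular torus geometry `ε_N < 1/2`), so the pairs owned by `q` (lex-min of the two start cells)
  are at most the pairs whose first member starts in `q` plus those whose second member does, and the latter are as many as
  the former: `ownedCount q ≤ 2 rowCount q` — the domination of owned counts by ROW counts that lets `LocalCountUI (i)`
  (typed on rows, wave-1 S7 audit R2a) control the truncation excess of `badWeight`.

Bookkeeping only (Cercignani–Illner–Pulvirenti 1994 §4.2; Gallagher–Saint-Raymond–Texier 2013 Prop. 4.1.1: finitely many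
collisions in bounded windows on the good set).
-/

noncomputable section

open MeasureTheory Set Filter Topology
open scoped ENNReal BigOperators Classical
open Literature.Analysis.FluidPDE Literature.MathematicalPhysics.KineticTheory
open Literature.MathematicalPhysics.KineticTheory.VelocityBlindPlacement

namespace Summit.AtomisticToContinuum.HydrodynamicLimit.Theorems.EquilibriumForecastLine

/-! ## The collision triples of a window -/

/-- The COLLISION TRIPLES `(s, i, j)` of the orbit of `z` with times in `W`: `s ∈ W` a collision time and `(i, j)` an
ordered contact pair at time `s` (the finite set behind every collision pair sum of the window; `∅` off the good set /
for unbounded windows, where it is not used). -/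
def collTriples {σ : ℝ} {N : ℕ} (Φ : Flow σ N) (W : Set ℝ) (z : Phase N) : Finset (ℝ × Fin (N + 1) × Fin (N + 1)) :=
  if h : (collisionTriples G3 (hsDiameter σ N) (fun t => Φ.flow t z) W).Finite then h.toFinset else ∅

/-- On the good set and a bounded window, `collTriples` lists the collision triples. [folklore] -/
theorem mem_collTriples {σ : ℝ} {N : ℕ} (Φ : Flow σ N) {z : Phase N} (hz : z ∈ Φ.good) {W : Set ℝ} {a b : ℝ}
    (hW : W ⊆ Icc a b) {e : ℝ × Fin (N + 1) × Fin (N + 1)} :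
    e ∈ collTriples Φ W z ↔ e.1 ∈ W ∧ e.2 ∈ contactPairs G3 (hsDiameter σ N) (Φ.flow e.1 z) := by
  have hfin := finite_collisionTriples (Φ.finite_collisionTimes_inter hz hW)
  rw [collTriples, dif_pos hfin, Set.Finite.mem_toFinset]
  rfl

/-- **Collision pair sums over a bounded window are finite sums over the collision triples** (good set). [folklore] -/
theorem collisionPairSum_eq_sum_collTriples {σ : ℝ} {N : ℕ} (Φ : Flow σ N) {z : Phase N} (hz : z ∈ Φ.good)
    {W : Set ℝ} {a b : ℝ} (hW : W ⊆ Icc a b) {M : Type*} [AddCommMonoid M]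
    (g : ℝ → Phase N → Fin (N + 1) → Fin (N + 1) → M) :
    Φ.collisionPairSum W g z = ∑ e ∈ collTriples Φ W z, g e.1 (Φ.flow e.1 z) e.2.1 e.2.2 := by
  have hfin0 := Φ.finite_collisionTimes_inter hz hW
  have hfin := finite_collisionTriples hfin0
  rw [collTriples, dif_pos hfin, HardSphereFlow.collisionPairSum,
    Literature.Analysis.FluidPDE.collisionPairSum_eq_finsum_triples hfin0, finsum_mem_eq_finite_toFinset_sum _ hfin]

/-- A collision triple is an ordered pair of DISTINCT particles. [folklore] -/
theorem ne_of_mem_collTriples {σ : ℝ} {N : ℕ} (Φ : Flow σ N) {z : Phase N} (hz : z ∈ Φ.good) {W : Set ℝ} {a b : ℝ}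
    (hW : W ⊆ Icc a b) {e : ℝ × Fin (N + 1) × Fin (N + 1)} (he : e ∈ collTriples Φ W z) : e.2.1 ≠ e.2.2 :=
  (mem_contactPairs.1 ((mem_collTriples Φ hz hW).1 he).2).1

/-- **Both orders.** In the regular torus geometry (`ε_N < 1/2`) the swapped pair of a collision triple is a collision
triple. [folklore] -/
theorem swap_mem_collTriples {σ : ℝ} {N : ℕ} (Φ : Flow σ N) {z : Phase N} (hz : z ∈ Φ.good) {W : Set ℝ} {a b : ℝ}
    (hW : W ⊆ Icc a b) (hε : hsDiameter σ N < 2⁻¹) {e : ℝ × Fin (N + 1) × Fin (N + 1)} :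
    (e.1, e.2.swap) ∈ collTriples Φ W z ↔ e ∈ collTriples Φ W z := by
  rw [mem_collTriples Φ hz hW, mem_collTriples Φ hz hW]
  exact and_congr Iff.rfl (swap_mem_contactPairs_iff (Torus.isHardSphereRegular_geometry hε))

/-- Re-indexing a sum over the collision triples by swapping the pair. [folklore] -/
theorem sum_collTriples_swap {σ : ℝ} {N : ℕ} (Φ : Flow σ N) {z : Phase N} (hz : z ∈ Φ.good) {W : Set ℝ} {a b : ℝ}
    (hW : W ⊆ Icc a b) (hε : hsDiameter σ N < 2⁻¹) (f : ℝ × Fin (N + 1) × Fin (N + 1) → ℝ) :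
    ∑ e ∈ collTriples Φ W z, f (e.1, e.2.swap) = ∑ e ∈ collTriples Φ W z, f e := by
  refine Finset.sum_nbij' (fun e => (e.1, e.2.swap)) (fun e => (e.1, e.2.swap)) (fun e he => ?_) (fun e he => ?_)
    (fun e _ => ?_) (fun e _ => ?_) (fun e _ => rfl)
  · exact (swap_mem_collTriples Φ hz hW hε).2 he
  · exact (swap_mem_collTriples Φ hz hW hε).2 he
  · simp
  · simp

/-! ## The cell-pair statistics of a step as sums over its triples -/

section Step

variable {σ : ℝ} {N : ℕ} (Φ : Flow σ N) {z : Phase N}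

/-- The step window is bounded. [folklore] -/
theorem stepWindow_subset_Icc (c σ : ℝ) (N k : ℕ) :
    stepWindow c σ N k ⊆ Icc ((k : ℝ) * stepLen c σ N) (((k : ℝ) + 1) * stepLen c σ N) := Ioc_subset_Icc_self

/-- `collPair` as a sum over the triples of the step. [folklore] -/
theorem collPair_eq_sum (hz : z ∈ Φ.good) (Ψ : V3 × V3 × V3 → ℝ) (c : ℝ) (k : ℕ) (q q' : Cell) :
    collPair Ψ c σ N Φ k q q' z = (cellCount c σ N * c)⁻¹ * ∑ e ∈ collTriples Φ (stepWindow c σ N k) z,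
      (if startCell c σ N Φ k z e.2.1 = q ∧ startCell c σ N Φ k z e.2.2 = q'
        then Ψ (markOf N (hsDiameter σ N) (Φ.flow e.1 z) e.2.1 e.2.2) else 0) := by
  unfold collPair
  rw [collisionPairSum_eq_sum_collTriples Φ hz (stepWindow_subset_Icc c σ N k)]

/-- `rowCount` as a sum over the triples of the step. [folklore] -/
theorem rowCount_eq_sum (hz : z ∈ Φ.good) (c : ℝ) (k : ℕ) (q : Cell) :
    rowCount c σ N Φ k q z = (cellCount c σ N * c)⁻¹ * ∑ e ∈ collTriples Φ (stepWindow c σ N k) z,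
      (if startCell c σ N Φ k z e.2.1 = q then (1 : ℝ) else 0) := by
  unfold rowCount
  rw [collisionPairSum_eq_sum_collTriples Φ hz (stepWindow_subset_Icc c σ N k)]

/-- `ownedCount` as a sum over the triples of the step. [folklore] -/
theorem ownedCount_eq_sum (hz : z ∈ Φ.good) (c : ℝ) (k : ℕ) (q : Cell) :
    ownedCount c σ N Φ k q z = (cellCount c σ N * c)⁻¹ * ∑ e ∈ collTriples Φ (stepWindow c σ N k) z,
      (if cellMin (startCell c σ N Φ k z e.2.1) (startCell c σ N Φ k z e.2.2) = q then (1 : ℝ) else 0) := by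
  unfold ownedCount
  rw [collisionPairSum_eq_sum_collTriples Φ hz (stepWindow_subset_Icc c σ N k)]

/-- **`|collPair Ψ| ≤ C · collPair 1`** for a mark test bounded by `C`. [folklore] -/
theorem abs_collPair_le (hz : z ∈ Φ.good) {Ψ : V3 × V3 × V3 → ℝ} {C : ℝ} (hC : ∀ p, |Ψ p| ≤ C) {c : ℝ}
    (hc : 0 < c) (hσ : 0 < σ) (k : ℕ) (q q' : Cell) :
    |collPair Ψ c σ N Φ k q q' z| ≤ C * collPair (fun _ => 1) c σ N Φ k q q' z := by
  rw [collPair_eq_sum Φ hz, collPair_eq_sum Φ hz, abs_mul, abs_of_nonneg (inv_nonneg.2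
    (mul_nonneg (cellCount_pos hc hσ N).le hc.le)), mul_left_comm]
  refine mul_le_mul_of_nonneg_left ?_ (inv_nonneg.2 (mul_nonneg (cellCount_pos hc hσ N).le hc.le))
  rw [Finset.mul_sum]
  refine (Finset.abs_sum_le_sum_abs _ _).trans (Finset.sum_le_sum fun e _ => ?_)
  split_ifs
  · rw [mul_one]; exact hC _
  · rw [abs_zero, mul_zero]

/-- **Summing `collPair` over the partner cell**: `Σ_{q' ∈ box} collPair Ψ (q, q') = (n̄c)⁻¹ Σ_{triples with start cell
of the first member q} Ψ(mark)`. [folklore] -/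
theorem sum_collPair_eq (hz : z ∈ Φ.good) (Ψ : V3 × V3 × V3 → ℝ) {c : ℝ} (hc : 0 < c) (hσ : 0 < σ) (k : ℕ)
    (q : Cell) :
    ∑ q' ∈ cellBox (c * meanFreePath σ N), collPair Ψ c σ N Φ k q q' z =
      (cellCount c σ N * c)⁻¹ * ∑ e ∈ collTriples Φ (stepWindow c σ N k) z,
        (if startCell c σ N Φ k z e.2.1 = q then Ψ (markOf N (hsDiameter σ N) (Φ.flow e.1 z) e.2.1 e.2.2) else 0) := by
  simp_rw [collPair_eq_sum Φ hz]
  rw [← Finset.mul_sum, Finset.sum_comm]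
  congr 1
  refine Finset.sum_congr rfl fun e _ => ?_
  have hmem := startCell_mem_cellBox (mul_pos hc (meanFreePath_pos hσ N)) Φ k z e.2.2
  by_cases hq : startCell c σ N Φ k z e.2.1 = q
  · simp only [hq, true_and, if_true]
    rw [Finset.sum_ite_eq (cellBox (c * meanFreePath σ N)) (startCell c σ N Φ k z e.2.2), if_pos hmem]
  · simp only [hq, false_and, if_false, Finset.sum_const_zero]

/-- `tsum` form of `sum_collPair_eq`. [folklore] -/
theorem tsum_collPair_eq (hz : z ∈ Φ.good) (Ψ : V3 × V3 × V3 → ℝ) {c : ℝ} (hc : 0 < c) (hσ : 0 < σ) (k : ℕ)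
    (q : Cell) :
    ∑' q' : Cell, collPair Ψ c σ N Φ k q q' z =
      (cellCount c σ N * c)⁻¹ * ∑ e ∈ collTriples Φ (stepWindow c σ N k) z,
        (if startCell c σ N Φ k z e.2.1 = q then Ψ (markOf N (hsDiameter σ N) (Φ.flow e.1 z) e.2.1 e.2.2) else 0) := by
  rw [← sum_collPair_eq Φ hz Ψ hc hσ k q]
  exact tsum_cell_eq_sum fun q' hq' =>
    collPair_eq_zero_of_not_mem (mul_pos hc (meanFreePath_pos hσ N)) Ψ Φ k (Or.inr hq') z

/-- **Rows**: `rowCount q = Σ_{q' ∈ box} collPair 1 (q, q')`. [folklore] -/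
theorem rowCount_eq_sum_collPair (hz : z ∈ Φ.good) {c : ℝ} (hc : 0 < c) (hσ : 0 < σ) (k : ℕ) (q : Cell) :
    rowCount c σ N Φ k q z = ∑ q' ∈ cellBox (c * meanFreePath σ N), collPair (fun _ => 1) c σ N Φ k q q' z := by
  rw [sum_collPair_eq Φ hz _ hc hσ, rowCount_eq_sum Φ hz]

/-- **The total count of a step**: `Σ_{q ∈ box} rowCount q = (n̄c)⁻¹ · #(collision triples of the step)`. [folklore] -/
theorem sum_rowCount_eq (hz : z ∈ Φ.good) {c : ℝ} (hc : 0 < c) (hσ : 0 < σ) (k : ℕ) :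
    ∑ q ∈ cellBox (c * meanFreePath σ N), rowCount c σ N Φ k q z =
      (cellCount c σ N * c)⁻¹ * ((collTriples Φ (stepWindow c σ N k) z).card : ℝ) := by
  simp_rw [rowCount_eq_sum Φ hz]
  rw [← Finset.mul_sum, Finset.sum_comm]
  congr 1
  rw [Finset.card_eq_sum_ones, Nat.cast_sum, Nat.cast_one]
  refine Finset.sum_congr rfl fun e _ => ?_
  rw [Finset.sum_ite_eq (cellBox (c * meanFreePath σ N)) (startCell c σ N Φ k z e.2.1),
    if_pos (startCell_mem_cellBox (mul_pos hc (meanFreePath_pos hσ N)) Φ k z e.2.1)]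

/-- `tsum` form of the total count. [folklore] -/
theorem tsum_rowCount_eq (hz : z ∈ Φ.good) {c : ℝ} (hc : 0 < c) (hσ : 0 < σ) (k : ℕ) :
    ∑' q : Cell, rowCount c σ N Φ k q z =
      (cellCount c σ N * c)⁻¹ * ((collTriples Φ (stepWindow c σ N k) z).card : ℝ) := by
  rw [← sum_rowCount_eq Φ hz hc hσ k]
  exact tsum_cell_eq_sum fun q hq => rowCount_eq_zero_of_not_mem (mul_pos hc (meanFreePath_pos hσ N)) Φ k hq z

/-- **A particle with more than `n̄ c T` collisions in the step forces `T < rowCount` of its start cell**: the number of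
triples of the step with first member `i` is at most `(n̄ c) · rowCount (startCell i)`. [folklore] -/
theorem card_filter_fst_le_rowCount (hz : z ∈ Φ.good) {c : ℝ} (hc : 0 < c) (hσ : 0 < σ) (k : ℕ) (i : Fin (N + 1)) :
    (((collTriples Φ (stepWindow c σ N k) z).filter fun e => e.2.1 = i).card : ℝ) ≤
      (cellCount c σ N * c) * rowCount c σ N Φ k (startCell c σ N Φ k z i) z := by
  have hpos : 0 < cellCount c σ N * c := mul_pos (cellCount_pos hc hσ N) hc
  rw [rowCount_eq_sum Φ hz, ← mul_assoc, mul_inv_cancel₀ hpos.ne', one_mul, Finset.card_eq_sum_ones, Nat.cast_sum,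
    Nat.cast_one, Finset.sum_filter]
  refine Finset.sum_le_sum fun e _ => ?_
  by_cases h : e.2.1 = i
  · rw [if_pos h, if_pos (by rw [h])]
  · rw [if_neg h]; positivity

/-- **Registered helper `ownedCount_le_two_mul_rowCount` (piece C1 of the docking S7): owned counts are dominated by
twice the row counts**, `ownedCount q ≤ 2 · rowCount q` on the good set (`0 < σ < 1/2`): a pair owned by `q` has a member
starting in `q`; pairs whose SECOND member starts in `q` are as many as pairs whose first member does (both orders of every
contact pair are present in the regular torus geometry). [folklore] -/
theorem ownedCount_le_two_mul_rowCount : ∀ {σ : ℝ} {N : ℕ} (Φ : Flow σ N) {z : Phase N}, z ∈ Φ.good → ∀ {c : ℝ}, 0 < c → 0 < σ → σ < 2⁻¹ → ∀ (k : ℕ) (q : Cell), ownedCount c σ N Φ k q z ≤ 2 * rowCount c σ N Φ k q z := by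
  intro σ N Φ z hz c hc hσ hσ2 k q
  have hε : hsDiameter σ N < 2⁻¹ := (hsDiameter_le hσ.le N).trans_lt hσ2
  have hW := stepWindow_subset_Icc c σ N k
  have hpos : 0 ≤ (cellCount c σ N * c)⁻¹ := inv_nonneg.2 (mul_pos (cellCount_pos hc hσ N) hc).le
  rw [ownedCount_eq_sum Φ hz, rowCount_eq_sum Φ hz, mul_left_comm]
  refine mul_le_mul_of_nonneg_left ?_ hpos
  -- pairs whose second member starts in `q` are as many as pairs whose first member does
  have hswap : ∑ e ∈ collTriples Φ (stepWindow c σ N k) z, (if startCell c σ N Φ k z e.2.2 = q then (1 : ℝ) else 0) =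
      ∑ e ∈ collTriples Φ (stepWindow c σ N k) z, (if startCell c σ N Φ k z e.2.1 = q then (1 : ℝ) else 0) := by
    rw [← sum_collTriples_swap Φ hz hW hε (fun e => if startCell c σ N Φ k z e.2.1 = q then (1 : ℝ) else 0)]
    rfl
  rw [two_mul]
  nth_rewrite 2 [← hswap]
  rw [← Finset.sum_add_distrib]
  refine Finset.sum_le_sum fun e _ => ?_
  rcases cellMin_mem_pair (startCell c σ N Φ k z e.2.1) (startCell c σ N Φ k z e.2.2) with hm | hm <;>
    rw [hm] <;> split_ifs <;> norm_num

end Step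

end Summit.AtomisticToContinuum.HydrodynamicLimit.Theorems.EquilibriumForecastLine

end
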